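import Summits.NavierStokesRegularity.NavierStokesRegularity.Theorems.PerpetualPumpAveragedTypeIBlowupChainContinuationTools
import Mathlib.Analysis.SpecialFunctions.Integrals.Basic

/-!
# Crux `PerpetualPump.AveragedTypeIBlowup` (stmt-NavierStokesRegularity-1835), line `Sketch`:
# tools for the stub `dieGlobal` — the Volterra chain against the dissipating heat kernels

T. Tao, *Finite time blowup for an averaged three-dimensional Navier–Stokes equation*, J. Amer.
Math. Soc. **29** (2016), 601–674 = arXiv:1402.0290v3, §4 p. 22 (4.14) and §5.2: the wavelet
coefficients of a mild solution of the cascade equation solve the exact Volterra chain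
`Y_{i,n}(t) = A 1_{(i,n)=(i₀,n₀)} k_{i,n}(t) + ∫₀ᵗ k_{i,n}(t-s) quadTerm(Y)_{i,n}(s) ds` whose kernels,
the heat kernels of the modes, dissipate at the rate of the scale:
`0 ≤ k_{i,n}(τ) ≤ e^{-4π²(1+ε₀)^{2n}τ}` (`τ ≥ 0`).

Helper file (theorems only) for the registered stub `stub_dieGlobal` ("critical smallness at one
time forces a global solution") of the lead's skeleton `Cruxes/AveragedTypeIBlowup/Lines/Sketch.lean`:

* `abs_quadTerm_le_of_two_weights`: the drive of scale `n` when one factor of every monomial is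
  measured in a weight `(1+ε₀)^{w₁k}` and the other in a weight `(1+ε₀)^{w₂k}`;
* `integral_exp_mul_add_le` and two special cases: `∫ₐᵇ e^{γs+d} ds ≤ e^{γb+d}/γ`;
* `abs_volterra_le_of_two_weights`: the Volterra term `∫ₐᵗ k_{i,n}(t-s) quadTerm_{i,n}(s) ds`
  against a dissipating kernel gains the factor `1/(4π²(1+ε₀)^{2n})`;
* `abs_memory_le`: after a time `t₀` the memory `A 1 k_{i,n}(t) + ∫₀^{t₀} k_{i,n}(t-s) quadTerm(s) ds`
  is bounded by the band-Duhamel majorant `b_{i,n}(t₀)`;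
* `chain_split`: `Y_{i,n}(t) = memory + ∫_{t₀}^t` for `t₀ ≤ t`;
* `stub_dieGlobalTools`: the registered sub-goal this file lands (the memory bound, closed form).

Nothing here closes the item (`--supports`); no statement of the route changes.

## References

* T. Tao, J. Amer. Math. Soc. 29 (2016), 601–674, arXiv:1402.0290v3, §4 p. 22 (4.14), §5.2.
  [`Tao2016AveragedNS`]
-/

noncomputable section

-- the summit namespace `…NavierStokesRegularity.NavierStokesRegularity…` is the tree convention
set_option linter.dupNamespace false

open MeasureTheory Set Filter Topology
open scoped ENNReal
open Literature.Analysis.FluidPDE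
open Literature.Analysis.FluidPDE.TaoCascade (quadTerm shiftSet mem_shiftSet_iff)

namespace Summit.NavierStokesRegularity.NavierStokesRegularity.Theorems.PerpetualPumpAveragedTypeIBlowup

variable {ε₀ : ℝ} {m : ℕ}

/-! ### The drive with two weights -/

/-- **The drive in two weights.** If every coefficient obeys `|X_{j,k}(s)| ≤ Z(1+ε₀)^{-w₁k}` and
`|X_{j,k}(s)| ≤ W(1+ε₀)^{-w₂k}` (`w₁, w₂ ≥ 0`), then measuring the first factor of each monomial of
`quadTerm_{i,n}` in the first weight and the second factor in the second weight,
`|quadTerm_{i,n}(X)(s)| ≤ (Σ_{i₁,i₂,μ}|α_{i₁,i₂,i,μ}|) Z W (1+ε₀)^e` as soon as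
`(5/2-w₁-w₂)n ≤ e` and `(5/2-w₁-w₂)(n-1) ≤ e` (the monomial with shift `μ` carries
`(1+ε₀)^{(5/2-w₁-w₂)(n-μ₃)-w₁μ₁-w₂μ₂}`, `μ₃ ∈ {0,1}`). [cite: Tao2016AveragedNS, §4 (4.8)] -/
theorem abs_quadTerm_le_of_two_weights (hε₀ : 0 < ε₀)
    (α : Fin m → Fin m → Fin m → ℤ × ℤ × ℤ → ℝ) {w₁ w₂ Z W e : ℝ} {n : ℤ} (hw₁ : 0 ≤ w₁)
    (hw₂ : 0 ≤ w₂) (hZ : 0 ≤ Z) (hW : 0 ≤ W) (he₀ : (5 / 2 - w₁ - w₂) * n ≤ e)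
    (he₁ : (5 / 2 - w₁ - w₂) * (n - 1) ≤ e) {X : Fin m → ℤ → ℝ → ℝ} {s : ℝ}
    (hXZ : ∀ (j : Fin m) (k : ℤ), |X j k s| ≤ Z * (1 + ε₀) ^ (-(w₁ * k)))
    (hXW : ∀ (j : Fin m) (k : ℤ), |X j k s| ≤ W * (1 + ε₀) ^ (-(w₂ * k))) (i : Fin m) :
    |quadTerm ε₀ α X i n s| ≤
      (∑ i₁ : Fin m, ∑ i₂ : Fin m, ∑ μ ∈ shiftSet, |α i₁ i₂ i μ|) * (Z * W) * (1 + ε₀) ^ e := by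
  have hL0 : 0 < 1 + ε₀ := by linarith
  have hL1 : 1 ≤ 1 + ε₀ := by linarith
  have key : ∀ {μ : ℤ × ℤ × ℤ}, μ ∈ shiftSet →
      (5 : ℝ) * (n - μ.2.2) / 2 + (-(w₁ * (n - μ.2.2 + μ.1 : ℤ)) + -(w₂ * (n - μ.2.2 + μ.2.1 : ℤ))) ≤
        e := by
    intro μ hμ
    obtain ⟨h1, h2, h3, h4, -⟩ := shiftSet_mem_bounds hμ
    have f1 : (0 : ℝ) ≤ μ.1 := by exact_mod_cast h1
    have f2 : (0 : ℝ) ≤ μ.2.1 := by exact_mod_cast h2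
    have p1 : 0 ≤ w₁ * (μ.1 : ℝ) := mul_nonneg hw₁ f1
    have p2 : 0 ≤ w₂ * (μ.2.1 : ℝ) := mul_nonneg hw₂ f2
    push_cast
    rcases (show μ.2.2 = 0 ∨ μ.2.2 = 1 by omega) with h | h
    · have f3 : (μ.2.2 : ℝ) = 0 := by exact_mod_cast h
      rw [f3]
      linarith
    · have f3 : (μ.2.2 : ℝ) = 1 := by exact_mod_cast h
      rw [f3]
      linarith
  unfold quadTerm
  refine (Finset.abs_sum_le_sum_abs _ _).trans ?_
  rw [Finset.sum_mul, Finset.sum_mul]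
  refine Finset.sum_le_sum fun i₁ _ => ?_
  refine (Finset.abs_sum_le_sum_abs _ _).trans ?_
  rw [Finset.sum_mul, Finset.sum_mul]
  refine Finset.sum_le_sum fun i₂ _ => ?_
  refine (Finset.abs_sum_le_sum_abs _ _).trans ?_
  rw [Finset.sum_mul, Finset.sum_mul]
  refine Finset.sum_le_sum fun μ hμ => ?_
  have hexp : (1 + ε₀) ^ ((5 : ℝ) * (n - μ.2.2) / 2) *
      ((1 + ε₀) ^ (-(w₁ * (n - μ.2.2 + μ.1 : ℤ))) * (1 + ε₀) ^ (-(w₂ * (n - μ.2.2 + μ.2.1 : ℤ)))) ≤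
      (1 + ε₀) ^ e := by
    rw [← Real.rpow_add hL0, ← Real.rpow_add hL0]
    exact Real.rpow_le_rpow_of_exponent_le hL1 (key hμ)
  rw [abs_mul, abs_mul, abs_of_pos (Real.rpow_pos_of_pos hL0 _), abs_mul]
  calc |α i₁ i₂ i μ| * (1 + ε₀) ^ ((5 : ℝ) * (n - μ.2.2) / 2) *
        (|X i₁ (n - μ.2.2 + μ.1) s| * |X i₂ (n - μ.2.2 + μ.2.1) s|)
      ≤ |α i₁ i₂ i μ| * (1 + ε₀) ^ ((5 : ℝ) * (n - μ.2.2) / 2) *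
          ((Z * (1 + ε₀) ^ (-(w₁ * (n - μ.2.2 + μ.1 : ℤ)))) *
            (W * (1 + ε₀) ^ (-(w₂ * (n - μ.2.2 + μ.2.1 : ℤ))))) :=
        mul_le_mul_of_nonneg_left (mul_le_mul (hXZ _ _) (hXW _ _) (abs_nonneg _) (by positivity))
          (by positivity)
    _ = |α i₁ i₂ i μ| * (Z * W) * ((1 + ε₀) ^ ((5 : ℝ) * (n - μ.2.2) / 2) *
          ((1 + ε₀) ^ (-(w₁ * (n - μ.2.2 + μ.1 : ℤ))) *
            (1 + ε₀) ^ (-(w₂ * (n - μ.2.2 + μ.2.1 : ℤ))))) := by ring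
    _ ≤ |α i₁ i₂ i μ| * (Z * W) * (1 + ε₀) ^ e := mul_le_mul_of_nonneg_left hexp (by positivity)

/-! ### Exponential integrals -/

/-- `∫ₐᵇ e^{γs+d} ds = (e^{γb+d} - e^{γa+d})/γ ≤ e^{γb+d}/γ` for `γ > 0`. [folklore] -/
theorem integral_exp_mul_add_le {γ d : ℝ} (a b : ℝ) (hγ : 0 < γ) :
    ∫ s in a..b, Real.exp (γ * s + d) ≤ Real.exp (γ * b + d) / γ := by
  have hderiv : ∀ x ∈ uIcc a b,
      HasDerivAt (fun s => Real.exp (γ * s + d) / γ) (Real.exp (γ * x + d)) x := by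
    intro x _
    have h1 : HasDerivAt (fun s => γ * s + d) γ x := by
      simpa using ((hasDerivAt_id x).const_mul γ).add_const d
    exact (h1.exp.div_const γ).congr_deriv (mul_div_cancel_right₀ _ hγ.ne')
  rw [intervalIntegral.integral_eq_sub_of_hasDerivAt hderiv
    ((Real.continuous_exp.comp (by fun_prop)).intervalIntegrable a b)]
  have : 0 ≤ Real.exp (γ * a + d) / γ := by positivity
  linarith

/-- `∫ₐᵇ e^{-c(b-s)} ds ≤ 1/c` for `c > 0`. [folklore] -/
theorem integral_exp_neg_mul_sub_le {c : ℝ} (a b : ℝ) (hc : 0 < c) :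
    ∫ s in a..b, Real.exp (-(c * (b - s))) ≤ 1 / c := by
  have h := integral_exp_mul_add_le (d := -(c * b)) a b hc
  have heq : ∫ s in a..b, Real.exp (-(c * (b - s))) = ∫ s in a..b, Real.exp (c * s + -(c * b)) :=
    intervalIntegral.integral_congr fun s _ => by
      show Real.exp (-(c * (b - s))) = Real.exp (c * s + -(c * b))
      congr 1
      ring
  rw [heq]
  refine h.trans_eq ?_
  rw [add_neg_cancel, Real.exp_zero]

/-- `∫ₐᵇ e^{γs} ds ≤ e^{γb}/γ` for `γ > 0`. [folklore] -/
theorem integral_exp_mul_le {γ : ℝ} (a b : ℝ) (hγ : 0 < γ) :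
    ∫ s in a..b, Real.exp (γ * s) ≤ Real.exp (γ * b) / γ := by
  have h := integral_exp_mul_add_le (d := 0) a b hγ
  simpa only [add_zero] using h

/-! ### The Volterra term against a dissipating kernel -/

/-- **The Volterra term of scale `n` against a dissipating kernel, in two weights.** For kernels
`0 ≤ k_{i,n}(τ) ≤ e^{-4π²(1+ε₀)^{2n}τ}` (`τ ≥ 0`) and a coefficient family obeying, at every time of
`[a,t]`, `|Y_{j,k}| ≤ Z(1+ε₀)^{-w₁k}` and `|Y_{j,k}| ≤ W(1+ε₀)^{-w₂k}`:
`|∫ₐᵗ k_{i,n}(t-s) quadTerm_{i,n}(Y)(s) ds| ≤ (Σ|α_{·,·,i,·}|) Z W (1+ε₀)^e / (4π²(1+ε₀)^{2n})`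
(`e` as in `abs_quadTerm_le_of_two_weights`; `∫ₐᵗ e^{-λ(t-s)} ds ≤ 1/λ`). [cite: Tao2016AveragedNS, §5.2] -/
theorem abs_volterra_le_of_two_weights (hε₀ : 0 < ε₀)
    (α : Fin m → Fin m → Fin m → ℤ × ℤ × ℤ → ℝ) (k : Fin m → ℤ → ℝ → ℝ)
    (hk0 : ∀ i n τ, 0 ≤ τ → 0 ≤ k i n τ)
    (hk1 : ∀ (i : Fin m) (n : ℤ) (τ : ℝ), 0 ≤ τ →
      k i n τ ≤ Real.exp (-(4 * Real.pi ^ 2 * (1 + ε₀) ^ (2 * n) * τ)))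
    {Y : Fin m → ℤ → ℝ → ℝ} {w₁ w₂ Z W e a t : ℝ} {n : ℤ} (hw₁ : 0 ≤ w₁) (hw₂ : 0 ≤ w₂)
    (hZ : 0 ≤ Z) (hW : 0 ≤ W) (he₀ : (5 / 2 - w₁ - w₂) * n ≤ e)
    (he₁ : (5 / 2 - w₁ - w₂) * (n - 1) ≤ e) (hat : a ≤ t)
    (hXZ : ∀ s ∈ Icc a t, ∀ (j : Fin m) (k' : ℤ), |Y j k' s| ≤ Z * (1 + ε₀) ^ (-(w₁ * k')))
    (hXW : ∀ s ∈ Icc a t, ∀ (j : Fin m) (k' : ℤ), |Y j k' s| ≤ W * (1 + ε₀) ^ (-(w₂ * k')))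
    (i : Fin m) :
    |∫ s in a..t, k i n (t - s) * quadTerm ε₀ α Y i n s| ≤
      (∑ i₁ : Fin m, ∑ i₂ : Fin m, ∑ μ ∈ shiftSet, |α i₁ i₂ i μ|) * (Z * W) * (1 + ε₀) ^ e /
        (4 * Real.pi ^ 2 * (1 + ε₀) ^ (2 * n)) := by
  set lam : ℝ := 4 * Real.pi ^ 2 * (1 + ε₀) ^ (2 * n) with hlam
  have hlam0 : 0 < lam := by positivity
  set C : ℝ := (∑ i₁ : Fin m, ∑ i₂ : Fin m, ∑ μ ∈ shiftSet, |α i₁ i₂ i μ|) * (Z * W) * (1 + ε₀) ^ e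
    with hC
  have hC0 : 0 ≤ C := by positivity
  have h1 : |∫ s in a..t, k i n (t - s) * quadTerm ε₀ α Y i n s| ≤
      ∫ s in a..t, C * Real.exp (-(lam * (t - s))) := by
    rw [← Real.norm_eq_abs]
    refine intervalIntegral.norm_integral_le_of_norm_le hat (Eventually.of_forall fun s hs => ?_) ?_
    · have hts : 0 ≤ t - s := sub_nonneg.2 hs.2
      rw [Real.norm_eq_abs, abs_mul, abs_of_nonneg (hk0 i n _ hts), mul_comm]
      exact mul_le_mul (abs_quadTerm_le_of_two_weights hε₀ α hw₁ hw₂ hZ hW he₀ he₁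
        (hXZ s ⟨hs.1.le, hs.2⟩) (hXW s ⟨hs.1.le, hs.2⟩) i) (hk1 i n _ hts) (hk0 i n _ hts) hC0
    · exact (continuous_const.mul (Real.continuous_exp.comp (by fun_prop))).intervalIntegrable a t
  refine h1.trans ?_
  rw [intervalIntegral.integral_const_mul]
  calc C * ∫ s in a..t, Real.exp (-(lam * (t - s))) ≤ C * (1 / lam) :=
        mul_le_mul_of_nonneg_left (integral_exp_neg_mul_sub_le a t hlam0) hC0
    _ = C / lam := by rw [mul_one_div]

/-! ### The memory after a time `t₀` -/

/-- **The memory is bounded by the band-Duhamel majorant.** For kernels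
`0 ≤ k_{i,n}(τ) ≤ e^{-4π²(1+ε₀)^{2n}τ}` (`τ ≥ 0`) and `0 ≤ t₀ ≤ t`, `t₀ < S`:
`|A 1 k_{i,n}(t) + ∫₀^{t₀} k_{i,n}(t-s) quadTerm_{i,n}(s) ds ≤
 e^{-4π²(1+ε₀)^{2n}t₀}|A|1 + ∫₀^{t₀} |quadTerm_{i,n}(s)| e^{-4π²(1+ε₀)^{2n}(t₀-s)} ds =: b_{i,n}(t₀)`. [cite: Tao2016AveragedNS, §5.2] -/
theorem abs_memory_le (hε₀ : 0 < ε₀) (α : Fin m → Fin m → Fin m → ℤ × ℤ × ℤ → ℝ)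
    (k : Fin m → ℤ → ℝ → ℝ) (hk0 : ∀ i n τ, 0 ≤ τ → 0 ≤ k i n τ)
    (hk1 : ∀ (i : Fin m) (n : ℤ) (τ : ℝ), 0 ≤ τ →
      k i n τ ≤ Real.exp (-(4 * Real.pi ^ 2 * (1 + ε₀) ^ (2 * n) * τ)))
    {Y : Fin m → ℤ → ℝ → ℝ} {S : ℝ} (hcont : ∀ i n, ContinuousOn (Y i n) (Ico 0 S)) (i₀ : Fin m)
    (n₀ : ℤ) (A : ℝ) (i : Fin m) (n : ℤ) {t₀ t : ℝ} (ht₀ : 0 ≤ t₀) (ht₀S : t₀ < S) (ht : t₀ ≤ t) :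
    |(if i = i₀ ∧ n = n₀ then A else 0) * k i n t +
        ∫ s in (0 : ℝ)..t₀, k i n (t - s) * quadTerm ε₀ α Y i n s| ≤
      Real.exp (-(4 * Real.pi ^ 2 * (1 + ε₀) ^ (2 * n) * t₀)) * (if i = i₀ ∧ n = n₀ then |A| else 0) +
        ∫ s in (0 : ℝ)..t₀, |quadTerm ε₀ α Y i n s| *
          Real.exp (-(4 * Real.pi ^ 2 * (1 + ε₀) ^ (2 * n) * (t₀ - s))) := by
  set lam : ℝ := 4 * Real.pi ^ 2 * (1 + ε₀) ^ (2 * n) with hlam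
  have hlam0 : 0 ≤ lam := by positivity
  have h0t : 0 ≤ t := ht₀.trans ht
  refine (abs_add_le _ _).trans (add_le_add ?_ ?_)
  · rw [abs_mul, mul_comm]
    have hk : |k i n t| ≤ Real.exp (-(lam * t₀)) := by
      rw [abs_of_nonneg (hk0 i n t h0t)]
      exact (hk1 i n t h0t).trans (Real.exp_le_exp.2 (neg_le_neg (mul_le_mul_of_nonneg_left ht hlam0)))
    have hif : |(if i = i₀ ∧ n = n₀ then A else 0)| = if i = i₀ ∧ n = n₀ then |A| else 0 := by
      split_ifs <;> simp
    rw [hif]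
    exact mul_le_mul_of_nonneg_right hk (by split_ifs <;> simp)
  · rw [← Real.norm_eq_abs]
    refine intervalIntegral.norm_integral_le_of_norm_le ht₀ (Eventually.of_forall fun s hs => ?_) ?_
    · have hts : 0 ≤ t - s := by linarith [hs.2]
      rw [Real.norm_eq_abs, abs_mul, abs_of_nonneg (hk0 i n _ hts), mul_comm]
      refine mul_le_mul_of_nonneg_left ((hk1 i n _ hts).trans (Real.exp_le_exp.2 (neg_le_neg ?_)))
        (abs_nonneg _)
      exact mul_le_mul_of_nonneg_left (by linarith) hlam0
    · refine ContinuousOn.intervalIntegrable ?_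
      rw [uIcc_of_le ht₀]
      exact (continuous_abs.comp_continuousOn ((quadTerm_continuousOn α hcont i n).mono
        fun s hs => ⟨hs.1, hs.2.trans_lt ht₀S⟩)).mul (Continuous.continuousOn (by fun_prop))

/-- **Splitting the chain at `t₀`**: for `0 ≤ t₀ ≤ t < S`,
`Y_{i,n}(t) = (A 1 k_{i,n}(t) + ∫₀^{t₀} k_{i,n}(t-s) quadTerm_{i,n}(s) ds) + ∫_{t₀}^t k_{i,n}(t-s) quadTerm_{i,n}(s) ds`. [cite: Tao2016AveragedNS, §4 p. 22 (4.14)] -/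
theorem chain_split (α : Fin m → Fin m → Fin m → ℤ × ℤ × ℤ → ℝ) (k : Fin m → ℤ → ℝ → ℝ)
    (hkc : ∀ i n, Continuous (k i n)) {Y : Fin m → ℤ → ℝ → ℝ} {S : ℝ}
    (hcont : ∀ i n, ContinuousOn (Y i n) (Ico 0 S)) (i₀ : Fin m) (n₀ : ℤ) (A : ℝ)
    (hchain : ∀ (i : Fin m) (n : ℤ), ∀ t ∈ Ico 0 S,
      Y i n t = (if i = i₀ ∧ n = n₀ then A else 0) * k i n t +
        ∫ s in (0 : ℝ)..t, k i n (t - s) * quadTerm ε₀ α Y i n s)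
    (i : Fin m) (n : ℤ) {t₀ t : ℝ} (ht₀ : 0 ≤ t₀) (ht : t₀ ≤ t) (htS : t < S) :
    Y i n t = ((if i = i₀ ∧ n = n₀ then A else 0) * k i n t +
        ∫ s in (0 : ℝ)..t₀, k i n (t - s) * quadTerm ε₀ α Y i n s) +
      ∫ s in t₀..t, k i n (t - s) * quadTerm ε₀ α Y i n s := by
  have hInt : ∀ c d : ℝ, uIcc c d ⊆ Ico 0 S →
      IntervalIntegrable (fun u => k i n (t - u) * quadTerm ε₀ α Y i n u) volume c d :=
    fun c d h => ((((hkc i n).comp (continuous_const.sub continuous_id)).continuousOn).mul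
      ((quadTerm_continuousOn α hcont i n).mono h)).intervalIntegrable
  rw [hchain i n t ⟨ht₀.trans ht, htS⟩, add_assoc,
    intervalIntegral.integral_add_adjacent_intervals (hInt 0 t₀ ?_) (hInt t₀ t ?_)]
  · rw [uIcc_of_le ht₀]
    exact fun u hu => ⟨hu.1, (hu.2.trans ht).trans_lt htS⟩
  · rw [uIcc_of_le ht]
    exact fun u hu => ⟨ht₀.trans hu.1, hu.2.trans_lt htS⟩

/-! ### The registered sub-goal -/

/-- **Registered sub-goal `stub_dieGlobalTools` of the stub `dieGlobal`**: after a time `t₀` the memory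
of the Volterra chain against dissipating kernels `0 ≤ k_{i,n}(τ) ≤ e^{-4π²(1+ε₀)^{2n}τ}` is bounded by
the band-Duhamel majorant at `t₀`,
`|A 1 k_{i,n}(t) + ∫₀^{t₀} k_{i,n}(t-s) quadTerm_{i,n}(s) ds| ≤ b_{i,n}(t₀)` for `t ≥ t₀`
(`abs_memory_le`). [cite: Tao2016AveragedNS, §5.2] -/
theorem stub_dieGlobalTools :
    ∀ {ε₀ : ℝ}, 0 < ε₀ → ∀ {m : ℕ} (α : Fin m → Fin m → Fin m → ℤ × ℤ × ℤ → ℝ)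
      (k : Fin m → ℤ → ℝ → ℝ), (∀ i n τ, 0 ≤ τ → 0 ≤ k i n τ) →
      (∀ (i : Fin m) (n : ℤ) (τ : ℝ), 0 ≤ τ →
        k i n τ ≤ Real.exp (-(4 * Real.pi ^ 2 * (1 + ε₀) ^ (2 * n) * τ))) →
      ∀ (Y : Fin m → ℤ → ℝ → ℝ) (S : ℝ), (∀ i n, ContinuousOn (Y i n) (Ico 0 S)) →
      ∀ (i₀ : Fin m) (n₀ : ℤ) (A : ℝ) (i : Fin m) (n : ℤ) (t₀ t : ℝ), 0 ≤ t₀ → t₀ < S → t₀ ≤ t →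
      |(if i = i₀ ∧ n = n₀ then A else 0) * k i n t +
          ∫ s in (0 : ℝ)..t₀, k i n (t - s) * quadTerm ε₀ α Y i n s| ≤
        Real.exp (-(4 * Real.pi ^ 2 * (1 + ε₀) ^ (2 * n) * t₀)) * (if i = i₀ ∧ n = n₀ then |A| else 0) +
          ∫ s in (0 : ℝ)..t₀, |quadTerm ε₀ α Y i n s| *
            Real.exp (-(4 * Real.pi ^ 2 * (1 + ε₀) ^ (2 * n) * (t₀ - s))) :=
  fun hε₀ _ α k hk0 hk1 _ _ hcont i₀ n₀ A i n _ _ ht₀ ht₀S ht =>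
    abs_memory_le hε₀ α k hk0 hk1 hcont i₀ n₀ A i n ht₀ ht₀S ht

end Summit.NavierStokesRegularity.NavierStokesRegularity.Theorems.PerpetualPumpAveragedTypeIBlowup

end
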